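import Literature.NumberTheory.GaloisCohomology.RestrictedRamificationEulerCharacteristicAdditive
import Literature.NumberTheory.GaloisRepresentations.CohomologicalDimensionProofs
import Literature.GroupTheory.ProfiniteSubquotients
import HarnessLib

/-!
# Tate's Euler-characteristic identity along short exact sequences of modules over an OPEN
# SUBGROUP `U ≤ G_{K,S}` (`K` totally complex): `cd_p(U) ≤ 2`, two-out-of-three, additivity

Topic `NumberTheory/GaloisCohomology`; namespace `Literature.NumberTheory.GaloisCohomology`.
THEOREMS ONLY (no definition, no named fact, no `sorry`, no instance; D-0026).  Lane «TATE-EPC-TC»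
of cell `bsd-eis` (road memo evidence #54 on stmt-BirchSwinnertonDyer-19032), brick (B1d-δ): the
currency of the lane's INTERNAL induction over open subgroups `U ≤ G_{K,S}` (brick B2's
`ContinuousRep.euler_coindOpen_iff`: `EPC_e(U, M) :⟺ #H⁰(U, M)·#H²(U, M)·#M^e = #H¹(U, M)` for the
restriction `ρ.restrict (subgroupIncl U)` of a `G_{K,S}`-module), complementing the `Γ_K`-module /
`restrictedCohomology` currency of `RestrictedRamificationEulerCharacteristicSES.lean` and the
`G_{K,S}`-currency `continuousCohomology_euler_X₂_of_isTotallyComplex` there.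

Milne, *Arithmetic Duality Theorems*, I §5 (proof of Thm. 5.1, p. 69): Lemma 5.3 ("`φ` is
multiplicative") is used at EVERY finite layer `K′/K` inside `K_S` ("an argument as in the proof
of Theorem 2.8 allows us to replace `K` by a larger field"); at a totally complex `K` the input
`H³ = 0` at the layer `U = G_{K′,S} ≤ G_{K,S}` is `cd_p(U) ≤ cd_p(G_{K,S}) ≤ 2` (Serre I §3.3
Prop. 14 — the tree's PROVED `groupCdLE_subgroup_of_isClosed_holds` — and NSW (8.3.18), the tree's
`groupCdLE_two_galoisGroupUnramifiedOutside_of_isTotallyComplex`).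

* §1 `groupCdLE_two_subgroup_of_isTotallyComplex` — **`cd_p(U) ≤ 2`** for every CLOSED subgroup
  `U ≤ G_{K,S}`, `K` totally complex, `S ⊇ S_p`; `subsingleton_continuousCohomology_subgroup_of_isPrimaryTorsion`
  — `H^q(U, A) = 0`, `q ≥ 3`, `A` discrete `p`-primary.
* §2 for a short exact sequence `0 → A₁ → A₂ → A₃ → 0` of discrete `U`-modules (`IsSES`), `A₁`
  `p`-primary, `A₂`, `A₃` finite, `H¹` finite and the relevant `H²` finite: the three two-out-of-three
  theorems `continuousCohomology_euler_X₂/X₃/X₁_subgroup_of_isTotallyComplex` for the identity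
  `#H⁰(U, Aᵢ)·#H²(U, Aᵢ)·#Aᵢ^e = #H¹(U, Aᵢ)` (any `e : ℕ`; `e = r₂(K)·[G_{K,S} : U]` is Tate's at
  the layer), and the additive `v_p` form `continuousCohomology_eulerChar_add_subgroup_of_isTotallyComplex`.
* §3 the same two missing directions and the additive form over `G_{K,S}` itself
  (`continuousCohomology_euler_X₃/X₁_of_isTotallyComplex`, `continuousCohomology_eulerChar_add_of_isTotallyComplex`).

## References
* J. S. Milne, *Arithmetic Duality Theorems*, 2nd ed. (2006), I §5 Thm. 5.1 and Lemma 5.3 (p. 69).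
  [MilneADT2006]
* J.-P. Serre, *Cohomologie galoisienne* / *Galois Cohomology* (1997), I §3.3 Prop. 14, I §2.2.
  [SerreGaloisCohomology1997]
* J. Neukirch, A. Schmidt, K. Wingberg, *Cohomology of Number Fields*, 2nd ed. (2008), (8.3.18).
  [NeukirchSchmidtWingberg2008]
-/

noncomputable section

open CategoryTheory Function NumberField Field IsDedekindDomain
open scoped NumberField

namespace Literature.NumberTheory.GaloisCohomology

open Literature.NumberTheory.GaloisRepresentations
open _root_.TopRep _root_.ContRepresentation _root_.ContinuousCohomology

variable {K : Type} [Field K] [NumberField K] [IsTotallyComplex K] (S : Set (HeightOneSpectrum (𝓞 K)))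

/-! ### §1. `cd_p(U) ≤ 2` for closed subgroups `U ≤ G_{K,S}` -/

section CdTwo

/-- **`cd_p(U) ≤ 2` for every closed subgroup `U` of `G_{K,S}`**, `K` totally complex, `S ∋` every
place above `p` (Serre I §3.3 Prop. 14 `cd_p(U) ≤ cd_p(G_{K,S})` — the tree's
`groupCdLE_subgroup_of_isClosed_holds` — and `cd_p(G_{K,S}) ≤ 2`, NSW (8.3.18)).
[cite: SerreGaloisCohomology1997, I §3.3 Prop. 14] [cite: NeukirchSchmidtWingberg2008, (8.3.18)] -/
theorem groupCdLE_two_subgroup_of_isTotallyComplex (p : ℕ) [Fact p.Prime]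
    (hSp : ∀ v : HeightOneSpectrum (𝓞 K), ((p : ℕ) : 𝓞 K) ∈ v.asIdeal → v ∈ S)
    (U : Subgroup (GaloisGroupUnramifiedOutside K S)) (hU : IsClosed (U : Set (GaloisGroupUnramifiedOutside K S))) :
    GroupCdLE U p 2 := by
  haveI : TotallyDisconnectedSpace (GaloisGroupUnramifiedOutside K S) :=
    Literature.GroupTheory.ProfiniteSubquotients.totallyDisconnectedSpace_quotient
      (ramificationSubgroup K S) (ramificationSubgroup_isClosed K S)
  exact groupCdLE_subgroup_of_isClosed_holds _ U hU p 2
    (groupCdLE_two_galoisGroupUnramifiedOutside_of_isTotallyComplex (K := K) S p hSp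
      ne_two_of_exists_isReal_of_isTotallyComplex)

/-- **`H^q(U, A) = 0` for `q ≥ 3`**, `U ≤ G_{K,S}` closed (e.g. open), `A` a discrete `p`-primary
`U`-module, `K` totally complex, `S ⊇ S_p`.
[cite: SerreGaloisCohomology1997, I §3.3 Prop. 14] [cite: NeukirchSchmidtWingberg2008, (8.3.18)] -/
theorem subsingleton_continuousCohomology_subgroup_of_isPrimaryTorsion (p : ℕ) [Fact p.Prime]
    (hSp : ∀ v : HeightOneSpectrum (𝓞 K), ((p : ℕ) : 𝓞 K) ∈ v.asIdeal → v ∈ S)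
    (U : Subgroup (GaloisGroupUnramifiedOutside K S)) (hU : IsClosed (U : Set (GaloisGroupUnramifiedOutside K S)))
    {A : Type} [AddCommGroup A] [TopologicalSpace A] [DiscreteTopology A]
    (τ : ContinuousRep U ℤ A) (hA : IsPrimaryTorsion p A) {q : ℕ} (hq : 2 < q) :
    Subsingleton (continuousCohomology q τ.toTopRep) :=
  groupCdLE_two_subgroup_of_isTotallyComplex S p hSp U hU A τ hA hq

end CdTwo

/-! ### §2. Two out of three and additivity over an open (closed) subgroup `U ≤ G_{K,S}` -/

section Subgroup

variable {U : Subgroup (GaloisGroupUnramifiedOutside K S)}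
variable {A₁ A₂ A₃ : Type}
  [AddCommGroup A₁] [TopologicalSpace A₁] [DiscreteTopology A₁]
  [AddCommGroup A₂] [TopologicalSpace A₂] [DiscreteTopology A₂]
  [AddCommGroup A₃] [TopologicalSpace A₃] [DiscreteTopology A₃]
  {τ₁ : ContinuousRep U ℤ A₁} {τ₂ : ContinuousRep U ℤ A₂} {τ₃ : ContinuousRep U ℤ A₃}
  {f : τ₁.toTopRep ⟶ τ₂.toTopRep} {g : τ₂.toTopRep ⟶ τ₃.toTopRep}

/-- **Middle term over `U`**: for a short exact sequence `0 → A₁ → A₂ → A₃ → 0` of discrete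
`U`-modules, `U ≤ G_{K,S}` closed, `K` totally complex, `S ⊇ S_p`, `A₁` `p`-primary, `A₂`, `A₃`
finite, `H¹(U, Aᵢ)` and `H²(U, A₁)`, `H²(U, A₂)` finite: the identities
`#H⁰(U, Aᵢ)·#H²(U, Aᵢ)·#Aᵢ^e = #H¹(U, Aᵢ)` for `i = 1, 3` give it for `i = 2`.
[cite: MilneADT2006, I §5 Lemma 5.3 (p. 69)] [cite: SerreGaloisCohomology1997, I §3.3 Prop. 14] -/
theorem continuousCohomology_euler_X₂_subgroup_of_isTotallyComplex (p : ℕ) [Fact p.Prime]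
    (hSp : ∀ v : HeightOneSpectrum (𝓞 K), ((p : ℕ) : 𝓞 K) ∈ v.asIdeal → v ∈ S)
    (hU : IsClosed (U : Set (GaloisGroupUnramifiedOutside K S)))
    (h : IsSES f g) (hA₁ : IsPrimaryTorsion p A₁) [Finite A₂] [Finite A₃]
    [Finite (continuousCohomology 1 τ₁.toTopRep)] [Finite (continuousCohomology 1 τ₂.toTopRep)]
    [Finite (continuousCohomology 1 τ₃.toTopRep)] [Finite (continuousCohomology 2 τ₁.toTopRep)]
    [Finite (continuousCohomology 2 τ₂.toTopRep)] (e : ℕ)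
    (h₁ : Nat.card (continuousCohomology 0 τ₁.toTopRep) * Nat.card (continuousCohomology 2 τ₁.toTopRep) *
        Nat.card A₁ ^ e = Nat.card (continuousCohomology 1 τ₁.toTopRep))
    (h₃ : Nat.card (continuousCohomology 0 τ₃.toTopRep) * Nat.card (continuousCohomology 2 τ₃.toTopRep) *
        Nat.card A₃ ^ e = Nat.card (continuousCohomology 1 τ₃.toTopRep)) :
    Nat.card (continuousCohomology 0 τ₂.toTopRep) * Nat.card (continuousCohomology 2 τ₂.toTopRep) *
        Nat.card A₂ ^ e = Nat.card (continuousCohomology 1 τ₂.toTopRep) := by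
  haveI : CompactSpace U := isCompact_iff_compactSpace.mp hU.isCompact
  haveI := subsingleton_continuousCohomology_subgroup_of_isPrimaryTorsion S p hSp U hU τ₁ hA₁
    (by norm_num : 2 < 3)
  exact h.euler_X₂ e h₁ h₃

/-- **Right term over `U`**: the identities for `i = 1, 2` give it for `i = 3`.
[cite: MilneADT2006, I §5 Lemma 5.3 (p. 69)] [cite: SerreGaloisCohomology1997, I §3.3 Prop. 14] -/
theorem continuousCohomology_euler_X₃_subgroup_of_isTotallyComplex (p : ℕ) [Fact p.Prime]
    (hSp : ∀ v : HeightOneSpectrum (𝓞 K), ((p : ℕ) : 𝓞 K) ∈ v.asIdeal → v ∈ S)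
    (hU : IsClosed (U : Set (GaloisGroupUnramifiedOutside K S)))
    (h : IsSES f g) (hA₁ : IsPrimaryTorsion p A₁) [Finite A₂] [Finite A₃]
    [Finite (continuousCohomology 1 τ₁.toTopRep)] [Finite (continuousCohomology 1 τ₂.toTopRep)]
    [Finite (continuousCohomology 1 τ₃.toTopRep)] [Finite (continuousCohomology 2 τ₁.toTopRep)]
    [Finite (continuousCohomology 2 τ₂.toTopRep)] (e : ℕ)
    (h₁ : Nat.card (continuousCohomology 0 τ₁.toTopRep) * Nat.card (continuousCohomology 2 τ₁.toTopRep) *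
        Nat.card A₁ ^ e = Nat.card (continuousCohomology 1 τ₁.toTopRep))
    (h₂ : Nat.card (continuousCohomology 0 τ₂.toTopRep) * Nat.card (continuousCohomology 2 τ₂.toTopRep) *
        Nat.card A₂ ^ e = Nat.card (continuousCohomology 1 τ₂.toTopRep)) :
    Nat.card (continuousCohomology 0 τ₃.toTopRep) * Nat.card (continuousCohomology 2 τ₃.toTopRep) *
        Nat.card A₃ ^ e = Nat.card (continuousCohomology 1 τ₃.toTopRep) := by
  haveI : CompactSpace U := isCompact_iff_compactSpace.mp hU.isCompact
  haveI := subsingleton_continuousCohomology_subgroup_of_isPrimaryTorsion S p hSp U hU τ₁ hA₁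
    (by norm_num : 2 < 3)
  exact h.euler_X₃ e h₁ h₂

/-- **Left term over `U`**: the identities for `i = 2, 3` give it for `i = 1`.
[cite: MilneADT2006, I §5 Lemma 5.3 (p. 69)] [cite: SerreGaloisCohomology1997, I §3.3 Prop. 14] -/
theorem continuousCohomology_euler_X₁_subgroup_of_isTotallyComplex (p : ℕ) [Fact p.Prime]
    (hSp : ∀ v : HeightOneSpectrum (𝓞 K), ((p : ℕ) : 𝓞 K) ∈ v.asIdeal → v ∈ S)
    (hU : IsClosed (U : Set (GaloisGroupUnramifiedOutside K S)))
    (h : IsSES f g) (hA₁ : IsPrimaryTorsion p A₁) [Finite A₂] [Finite A₃]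
    [Finite (continuousCohomology 1 τ₁.toTopRep)] [Finite (continuousCohomology 1 τ₂.toTopRep)]
    [Finite (continuousCohomology 1 τ₃.toTopRep)] [Finite (continuousCohomology 2 τ₁.toTopRep)]
    [Finite (continuousCohomology 2 τ₂.toTopRep)] (e : ℕ)
    (h₂ : Nat.card (continuousCohomology 0 τ₂.toTopRep) * Nat.card (continuousCohomology 2 τ₂.toTopRep) *
        Nat.card A₂ ^ e = Nat.card (continuousCohomology 1 τ₂.toTopRep))
    (h₃ : Nat.card (continuousCohomology 0 τ₃.toTopRep) * Nat.card (continuousCohomology 2 τ₃.toTopRep) *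
        Nat.card A₃ ^ e = Nat.card (continuousCohomology 1 τ₃.toTopRep)) :
    Nat.card (continuousCohomology 0 τ₁.toTopRep) * Nat.card (continuousCohomology 2 τ₁.toTopRep) *
        Nat.card A₁ ^ e = Nat.card (continuousCohomology 1 τ₁.toTopRep) := by
  haveI : CompactSpace U := isCompact_iff_compactSpace.mp hU.isCompact
  haveI := subsingleton_continuousCohomology_subgroup_of_isPrimaryTorsion S p hSp U hU τ₁ hA₁
    (by norm_num : 2 < 3)
  exact h.euler_X₁ e h₂ h₃

/-- **Additivity of the `v_p`-Euler characteristic over `U`**: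
`χ(A₂) = χ(A₁) + χ(A₃)`, `χ(A) := v_p #H⁰(U, A) − v_p #H¹(U, A) + v_p #H²(U, A) + e·v_p #A ∈ ℤ`,
for a short exact sequence of discrete `U`-modules as above (all nine groups finite — `H²(U, A₃)`
is then finite too — and `H³(U, A₁) = 0` by §1).
[cite: MilneADT2006, I §5 Lemma 5.3 (p. 69)] [cite: SerreGaloisCohomology1997, I §3.3 Prop. 14] -/
theorem continuousCohomology_eulerChar_add_subgroup_of_isTotallyComplex (p : ℕ) [Fact p.Prime]
    (hSp : ∀ v : HeightOneSpectrum (𝓞 K), ((p : ℕ) : 𝓞 K) ∈ v.asIdeal → v ∈ S)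
    (hU : IsClosed (U : Set (GaloisGroupUnramifiedOutside K S)))
    (h : IsSES f g) (hA₁ : IsPrimaryTorsion p A₁) [Finite A₂] [Finite A₃]
    [Finite (continuousCohomology 1 τ₁.toTopRep)] [Finite (continuousCohomology 1 τ₂.toTopRep)]
    [Finite (continuousCohomology 1 τ₃.toTopRep)] [Finite (continuousCohomology 2 τ₁.toTopRep)]
    [Finite (continuousCohomology 2 τ₂.toTopRep)] (e : ℕ) :
    ((padicValNat p (Nat.card (continuousCohomology 0 τ₂.toTopRep)) : ℤ) -
          padicValNat p (Nat.card (continuousCohomology 1 τ₂.toTopRep)) +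
          padicValNat p (Nat.card (continuousCohomology 2 τ₂.toTopRep)) +
        e * padicValNat p (Nat.card A₂)) =
      ((padicValNat p (Nat.card (continuousCohomology 0 τ₁.toTopRep)) : ℤ) -
            padicValNat p (Nat.card (continuousCohomology 1 τ₁.toTopRep)) +
            padicValNat p (Nat.card (continuousCohomology 2 τ₁.toTopRep)) +
          e * padicValNat p (Nat.card A₁)) +
        ((padicValNat p (Nat.card (continuousCohomology 0 τ₃.toTopRep)) : ℤ) -
            padicValNat p (Nat.card (continuousCohomology 1 τ₃.toTopRep)) +
            padicValNat p (Nat.card (continuousCohomology 2 τ₃.toTopRep)) +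
          e * padicValNat p (Nat.card A₃)) := by
  haveI : CompactSpace U := isCompact_iff_compactSpace.mp hU.isCompact
  haveI := subsingleton_continuousCohomology_subgroup_of_isPrimaryTorsion S p hSp U hU τ₁ hA₁
    (by norm_num : 2 < 3)
  haveI : Finite A₁ := Finite.of_injective _ h.injective
  haveI : Finite (continuousCohomology 2 τ₃.toTopRep) := h.finite_two_X₃
  haveI : Finite (continuousCohomology 0 τ₁.toTopRep) := finite_continuousCohomology_zero _
  haveI : Finite (continuousCohomology 0 τ₂.toTopRep) := finite_continuousCohomology_zero _
  haveI : Finite (continuousCohomology 0 τ₃.toTopRep) := finite_continuousCohomology_zero _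
  exact padicValNat_euler_add_of_card_nineTerm p e
    Nat.card_pos.ne' Nat.card_pos.ne' Nat.card_pos.ne' Nat.card_pos.ne'
    Nat.card_pos.ne' Nat.card_pos.ne' Nat.card_pos.ne' Nat.card_pos.ne'
    Nat.card_pos.ne' Nat.card_pos.ne' Nat.card_pos.ne' Nat.card_pos.ne' (h.card_nineTerm_euler_zero e)

end Subgroup

/-! ### §3. The remaining directions and the additive form over `G_{K,S}` itself -/

section GS

variable {A₁ A₂ A₃ : Type}
  [AddCommGroup A₁] [TopologicalSpace A₁] [DiscreteTopology A₁]
  [AddCommGroup A₂] [TopologicalSpace A₂] [DiscreteTopology A₂]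
  [AddCommGroup A₃] [TopologicalSpace A₃] [DiscreteTopology A₃]
  {τ₁ : ContinuousRep (GaloisGroupUnramifiedOutside K S) ℤ A₁}
  {τ₂ : ContinuousRep (GaloisGroupUnramifiedOutside K S) ℤ A₂}
  {τ₃ : ContinuousRep (GaloisGroupUnramifiedOutside K S) ℤ A₃}
  {f : τ₁.toTopRep ⟶ τ₂.toTopRep} {g : τ₂.toTopRep ⟶ τ₃.toTopRep}

/-- **Right term over `G_{K,S}`** (companion of `continuousCohomology_euler_X₂_of_isTotallyComplex`):
the identities for `i = 1, 2` give it for `i = 3`.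
[cite: MilneADT2006, I §5 Lemma 5.3 (p. 69)] [cite: NeukirchSchmidtWingberg2008, (8.3.18)] -/
theorem continuousCohomology_euler_X₃_of_isTotallyComplex (p : ℕ) [Fact p.Prime]
    (hSp : ∀ v : HeightOneSpectrum (𝓞 K), ((p : ℕ) : 𝓞 K) ∈ v.asIdeal → v ∈ S)
    (h : IsSES f g) (hA₁ : IsPrimaryTorsion p A₁) [Finite A₂] [Finite A₃]
    [Finite (continuousCohomology 1 τ₁.toTopRep)] [Finite (continuousCohomology 1 τ₂.toTopRep)]
    [Finite (continuousCohomology 1 τ₃.toTopRep)] [Finite (continuousCohomology 2 τ₁.toTopRep)]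
    [Finite (continuousCohomology 2 τ₂.toTopRep)] (e : ℕ)
    (h₁ : Nat.card (continuousCohomology 0 τ₁.toTopRep) * Nat.card (continuousCohomology 2 τ₁.toTopRep) *
        Nat.card A₁ ^ e = Nat.card (continuousCohomology 1 τ₁.toTopRep))
    (h₂ : Nat.card (continuousCohomology 0 τ₂.toTopRep) * Nat.card (continuousCohomology 2 τ₂.toTopRep) *
        Nat.card A₂ ^ e = Nat.card (continuousCohomology 1 τ₂.toTopRep)) :
    Nat.card (continuousCohomology 0 τ₃.toTopRep) * Nat.card (continuousCohomology 2 τ₃.toTopRep) *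
        Nat.card A₃ ^ e = Nat.card (continuousCohomology 1 τ₃.toTopRep) := by
  haveI := subsingleton_continuousCohomology_of_isPrimaryTorsion_of_isTotallyComplex S p hSp τ₁ hA₁
    (by norm_num : 2 < 3)
  exact h.euler_X₃ e h₁ h₂

/-- **Left term over `G_{K,S}`**: the identities for `i = 2, 3` give it for `i = 1`.
[cite: MilneADT2006, I §5 Lemma 5.3 (p. 69)] [cite: NeukirchSchmidtWingberg2008, (8.3.18)] -/
theorem continuousCohomology_euler_X₁_of_isTotallyComplex (p : ℕ) [Fact p.Prime]
    (hSp : ∀ v : HeightOneSpectrum (𝓞 K), ((p : ℕ) : 𝓞 K) ∈ v.asIdeal → v ∈ S)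
    (h : IsSES f g) (hA₁ : IsPrimaryTorsion p A₁) [Finite A₂] [Finite A₃]
    [Finite (continuousCohomology 1 τ₁.toTopRep)] [Finite (continuousCohomology 1 τ₂.toTopRep)]
    [Finite (continuousCohomology 1 τ₃.toTopRep)] [Finite (continuousCohomology 2 τ₁.toTopRep)]
    [Finite (continuousCohomology 2 τ₂.toTopRep)] (e : ℕ)
    (h₂ : Nat.card (continuousCohomology 0 τ₂.toTopRep) * Nat.card (continuousCohomology 2 τ₂.toTopRep) *
        Nat.card A₂ ^ e = Nat.card (continuousCohomology 1 τ₂.toTopRep))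
    (h₃ : Nat.card (continuousCohomology 0 τ₃.toTopRep) * Nat.card (continuousCohomology 2 τ₃.toTopRep) *
        Nat.card A₃ ^ e = Nat.card (continuousCohomology 1 τ₃.toTopRep)) :
    Nat.card (continuousCohomology 0 τ₁.toTopRep) * Nat.card (continuousCohomology 2 τ₁.toTopRep) *
        Nat.card A₁ ^ e = Nat.card (continuousCohomology 1 τ₁.toTopRep) := by
  haveI := subsingleton_continuousCohomology_of_isPrimaryTorsion_of_isTotallyComplex S p hSp τ₁ hA₁
    (by norm_num : 2 < 3)
  exact h.euler_X₁ e h₂ h₃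

/-- **Additivity of the `v_p`-Euler characteristic over `G_{K,S}`**:
`χ(A₂) = χ(A₁) + χ(A₃)` with `χ(A) := v_p #H⁰(G_{K,S}, A) − v_p #H¹ + v_p #H² + e·v_p #A ∈ ℤ`, for a
short exact sequence of discrete `G_{K,S}`-modules, `A₁` `p`-primary, `A₂`, `A₃` finite, the `H¹`
and `H²(A₁)`, `H²(A₂)` finite, `K` totally complex, `S ⊇ S_p`.
[cite: MilneADT2006, I §5 Lemma 5.3 (p. 69)] [cite: NeukirchSchmidtWingberg2008, (8.3.18)] -/
theorem continuousCohomology_eulerChar_add_of_isTotallyComplex (p : ℕ) [Fact p.Prime]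
    (hSp : ∀ v : HeightOneSpectrum (𝓞 K), ((p : ℕ) : 𝓞 K) ∈ v.asIdeal → v ∈ S)
    (h : IsSES f g) (hA₁ : IsPrimaryTorsion p A₁) [Finite A₂] [Finite A₃]
    [Finite (continuousCohomology 1 τ₁.toTopRep)] [Finite (continuousCohomology 1 τ₂.toTopRep)]
    [Finite (continuousCohomology 1 τ₃.toTopRep)] [Finite (continuousCohomology 2 τ₁.toTopRep)]
    [Finite (continuousCohomology 2 τ₂.toTopRep)] (e : ℕ) :
    ((padicValNat p (Nat.card (continuousCohomology 0 τ₂.toTopRep)) : ℤ) -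
          padicValNat p (Nat.card (continuousCohomology 1 τ₂.toTopRep)) +
          padicValNat p (Nat.card (continuousCohomology 2 τ₂.toTopRep)) +
        e * padicValNat p (Nat.card A₂)) =
      ((padicValNat p (Nat.card (continuousCohomology 0 τ₁.toTopRep)) : ℤ) -
            padicValNat p (Nat.card (continuousCohomology 1 τ₁.toTopRep)) +
            padicValNat p (Nat.card (continuousCohomology 2 τ₁.toTopRep)) +
          e * padicValNat p (Nat.card A₁)) +
        ((padicValNat p (Nat.card (continuousCohomology 0 τ₃.toTopRep)) : ℤ) -
            padicValNat p (Nat.card (continuousCohomology 1 τ₃.toTopRep)) +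
            padicValNat p (Nat.card (continuousCohomology 2 τ₃.toTopRep)) +
          e * padicValNat p (Nat.card A₃)) := by
  haveI := subsingleton_continuousCohomology_of_isPrimaryTorsion_of_isTotallyComplex S p hSp τ₁ hA₁
    (by norm_num : 2 < 3)
  haveI : Finite A₁ := Finite.of_injective _ h.injective
  haveI : Finite (continuousCohomology 2 τ₃.toTopRep) := h.finite_two_X₃
  haveI : Finite (continuousCohomology 0 τ₁.toTopRep) := finite_continuousCohomology_zero _
  haveI : Finite (continuousCohomology 0 τ₂.toTopRep) := finite_continuousCohomology_zero _
  haveI : Finite (continuousCohomology 0 τ₃.toTopRep) := finite_continuousCohomology_zero _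
  exact padicValNat_euler_add_of_card_nineTerm p e
    Nat.card_pos.ne' Nat.card_pos.ne' Nat.card_pos.ne' Nat.card_pos.ne'
    Nat.card_pos.ne' Nat.card_pos.ne' Nat.card_pos.ne' Nat.card_pos.ne'
    Nat.card_pos.ne' Nat.card_pos.ne' Nat.card_pos.ne' Nat.card_pos.ne' (h.card_nineTerm_euler_zero e)

end GS

end Literature.NumberTheory.GaloisCohomology

end
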